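import Literature.AlgebraicGeometry.AbelianSchemes.IsLambdaOfAtBezout
import Literature.AlgebraicGeometry.AbelianSchemes.IsLambdaOfAtWitnessCongruence
import Literature.AlgebraicGeometry.AbelianSchemes.PolarizationKernelSubsetKTheta
import Literature.AlgebraicGeometry.AbelianSchemes.PolarizationSymmetricWitness
import Literature.AlgebraicGeometry.AbelianSchemes.ExistsAmpleOfMultipliedIdentity
import Literature.AlgebraicGeometry.AbelianVarieties.AmplePicZeroTwist
import Literature.AlgebraicGeometry.AbelianVarieties.AbelianVarietyWeilDivisorBundleDictionary
import Literature.AlgebraicGeometry.AbelianVarieties.NeronSeveriHalfOfTwoTorsion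
import Literature.AlgebraicGeometry.Motives.AlgPointsMapSurjectiveAlgClosed
import HarnessLib

/-!
# The SQUARE ROOT of `Λ`: `λ̄² = Λ(𝒪(2•Θ₁))` ⇒ `λ̄ = Λ(𝒪(Θ₁))`, and the (V)-upgrade «`λ̄² = Λ(ample)` ⇒ `λ̄ = Λ(ample)`»
# ([MumfordAV1970] §23 Thm. 3 at `n = 2`; [GortzWedhorn2023] Prop. 27.284) — edition 2, UNCONDITIONAL in characteristic `0`

Layer `Literature/AlgebraicGeometry/AbelianSchemes`, namespace `Literature.AlgebraicGeometry.AbelianSchemes.AbelianSchemeOver`.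
THEOREMS ONLY (no definition, no named fact, no instance, no notation, no `sorry`).  Cell hodgecm-mathlib (D-0151), F-DAG leaf
F-6 (V) «(V)-upgrade» (director s224 (ii); census `B-provers/B-p03/g17/CENSUS-Vup-HalfOfLambda.B-p03g17.md`, file G4 = the wrapper in
the `IsLambdaOfAt` currency of [MumfordFogartyKirwan1994] Def. 6.2–6.3).  HC_CM is proved only modulo the 7 printed citations until
rung 0 closes; nothing here is about HC.

EDITION 2 (same seven declaration names; §1–§3 and `exists_comp_pow_eq_of_exists_comp_eq` byte-identical to edition 1).  In edition 1
the heads of §4/§5 carried the Néron–Severi halving as an explicit hypothesis binder `hH2` («`A_s[2] ⊆ K(Θ)` + a non-zero section of an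
odd multiple ⇒ a half `Θ₁` with `t_a^*Θ + 2•Θ₁ ∼ Θ + 2•t_a^*Θ₁` for all `a`»), together with `h2 : (2 : Ω) ≠ 0` (and `h3`).  That
halving is now the theorem ★ `Motives.AbelianVariety.exists_forall_linEquiv_two_smul_of_isSection`
(`AbelianVarieties/NeronSeveriHalfOfTwoTorsion`, [MumfordAV1970] §23 Thm. 3 at `n = 2`: theta-function eigendivisor ★
`TranslationEigenDivisor` → descent through `[2]` ★ `InvariantDivisorDescentMulTwo` → Néron–Severi bookkeeping ★
`NeronSeveriHalfOfTwoTorsionInvariant`), proved over an algebraically closed field of CHARACTERISTIC `0`; accordingly the §4/§5 heads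
now assume `[CharZero Ω]` and the binders `hH2`, `h2`, `h3` are gone.

SETTING.  `A/S` an abelian scheme over a reduced locally Noetherian base with a dual pair `D = (Â, 𝒫)` (unit hypothesis `hD`),
`s : Spec Ω → S` a geometric point (`Ω` algebraically closed; `2 ≠ 0` in `Ω` for §1, characteristic `0` for §4/§5), `λ : A → Â` a
homomorphism, divisors on the fibre `A_s`; `λ̄ = Λ(𝒪(Θ))` at `s` is ★ `IsLambdaOfAt s D λ Θ` (`𝒫|_{A_s × {λ̄(P)}} ≅ t_P^*𝒪(Θ) ⊗ 𝒪(Θ)⁻¹`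
for all `P ∈ A_s(Ω)`).

* §1 **`IsLambdaOfAt.of_sq_two_smul`** — THE SQUARE ROOT: `λ̄² = Λ(𝒪(2•Θ₁))` ⇒ `λ̄ = Λ(𝒪(Θ₁))`.  For `P = Q²` (★ divisibility
  `exists_pow_eq_of_isAlgClosed`) the slice at `λ̄(P) = λ̄²(Q)` (★ `sliceAt_pow`) is `t_Q^*𝒪(2Θ₁) ⊗ 𝒪(2Θ₁)⁻¹`, and
  `D_Q(2•Θ₁) ∼ 2•D_Q(Θ₁) ∼ D_{Q²}(Θ₁)` (theorem of the square ★ `weilDiv_mul_linEquiv`); ★ (D-2) dictionary.  This is the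
  «homomorphism out of the divisible group `A_s(Ω)` killed by `2` is trivial» step of [MumfordAV1970] §23 / ★ `LDeltaHalfPicZero` §2,
  run on the slices themselves.
* §2 `IsLambdaOfAt.linEquiv_pullback_translation_of_sq` — `λ̄² = Λ(𝒪(Θ))` ⇒ `A_s[2](Ω) ⊆ K(Θ)` (`λ̄²(x) = λ̄(x²) = λ̄(1)`, ★
  `valueAt_pow`, ★ `weilDiv_linEquiv_zero_of_valueAt_eq_valueAt_one`) — the input of G1 ★ `TranslationEigenDivisor`.
* §3 `IsLambdaOfAt.sq_two_smul_of_forall_linEquiv`, `forall_linEquiv_pullback_translation_sub_two_smul`, `linEquiv_two_smul_add_sub` —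
  class bookkeeping for a NÉRON–SEVERI HALF `Θ₁` of `Θ` («`t_a^*Θ + 2•Θ₁ ∼ Θ + 2•t_a^*Θ₁` for all `a`», the output shape of files
  G2/G3): `λ̄² = Λ(𝒪(2•Θ₁))`, `N := Θ − 2•Θ₁` is translation invariant, `Θ ∼ 2•Θ₁ + N`.
* §4 **`exists_isAmple_isLambdaOfAt_of_sq`** — THE (V)-UPGRADE AT A GEOMETRIC POINT (characteristic `0`): `λ̄² = Λ(𝒪(Θ))` with `Θ`
  ample carrying a non-zero section of an odd multiple ⇒ `λ̄ = Λ(𝒪(Θ₁))` with `Θ₁` AMPLE (the Néron–Severi half ★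
  `exists_forall_linEquiv_two_smul_of_isSection`; ★ B-p12 `IsLambdaOfAt.isAmple_of_linEquiv_smul_add`: ample `∼ 2•Θ₁ +`
  translation-invariant ⇒ `Θ₁` ample, given `λ̄²` onto on `Ω`-points).
* §5 `exists_comp_pow_eq_of_exists_comp_eq` — `λ̄` onto on `Ω`-points ⇒ `λ̄ⁿ` onto (`n ≠ 0` in `Ω`; divisibility of `Â_s(Ω)`);
  **`exists_isAmple_isLambdaOfAt_of_pow_six_of_sq`** — THE `H₅` ENTRY of MFK Prop. 7.3 step (V) in the tree's hom form
  (B-p17 (g12) census `CENSUS-F6V-LDeltaCubeLocus` §5), characteristic `0`: from `λ̄⁶ = Λ(𝒪(Θ₆))` (`Θ₆` = the hyperplane divisor: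
  ample, with a section) and `λ̄² = Λ(𝒪(Θ_Δ))` (`L ≅ L^Δ(λ)^{⊗3}`), an AMPLE `Θ` with `λ̄ = Λ(𝒪(Θ))` — i.e. `λ` IS A POLARIZATION at `s`
  ([MumfordFogartyKirwan1994] Def. 6.3 `exists_ample`): §4 at `λ³` halves `λ̄⁶`, ★ Bezout `IsLambdaOfAt.bezout_of_pow` (`3 = 2·1+1`),
  ampleness by the `6•`-twist.

## References
* [MumfordAV1970] D. Mumford, *Abelian Varieties* (1970), §23 Thm. 3 (p. 231), §8 Thm. 1 (p. 77), §6 App. 1 (p. 60).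
* [MumfordFogartyKirwan1994] D. Mumford, J. Fogarty, F. Kirwan, *Geometric Invariant Theory*, 3rd ed. (1994), Ch. 6 §2 Def. 6.2–6.3
  (p. 120), Prop. 6.10–6.11 (pp. 121–123), Ch. 7 §2 Prop. 7.3 step (V) (p. 134).
* [GortzWedhorn2023] U. Görtz, T. Wedhorn, *Algebraic Geometry II* (2023), Def. 27.280, Prop. 27.284.
-/

noncomputable section

universe u

open CategoryTheory CategoryTheory.Limits AlgebraicGeometry MonoidalCategory

namespace Literature.AlgebraicGeometry.AbelianSchemes

open Literature.AlgebraicGeometry.Motives Literature.AlgebraicGeometry.AbelianVarieties Literature.AlgebraicGeometry.Modules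
open scoped MonObj

namespace AbelianSchemeOver

variable {S : Scheme.{u}} (A : AbelianSchemeOver S) (D : A.DualPair) {Ω : Type u} [Field Ω] (s : Spec (.of Ω) ⟶ S)

/-! ## §1 The square root of `Λ` -/

/-- **THE SQUARE ROOT OF `Λ`: `λ̄² = Λ(𝒪(2•Θ₁))` at `s` ⇒ `λ̄ = Λ(𝒪(Θ₁))` at `s`** (`Ω` algebraically closed, `2 ≠ 0`): for
`P = Q²`, `𝒫|_{λ̄(P)} = 𝒫|_{λ̄²(Q)} ≅ t_Q^*𝒪(2Θ₁) ⊗ 𝒪(2Θ₁)⁻¹` and `D_Q(2•Θ₁) ∼ D_{Q²}(Θ₁)`.  [MumfordAV1970] §23 (the hom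
`λ̄ − Λ(Θ₁)` out of the divisible `A_s(Ω)` is killed by `2`, hence trivial). [cite: MumfordAV1970, §23 Thm. 3 (p. 231)]
[cite: MumfordFogartyKirwan1994, Ch. 6 §2 Definition 6.2–6.3 (p. 120)] -/
theorem IsLambdaOfAt.of_sq_two_smul [IsAlgClosed Ω] (h2 : (2 : Ω) ≠ 0) {lam : A.X ⟶ D.hat.X} [IsMonHom lam]
    {Θ₁ : CartierDivisor (A.fibre s).toAbelianVariety.X.left} (h : A.IsLambdaOfAt s D (lam ^ 2) (2 • Θ₁)) :
    A.IsLambdaOfAt s D lam Θ₁ := by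
  intro P
  obtain ⟨Q, hQ⟩ := (A.fibre s).toAbelianVariety.exists_pow_eq_of_isAlgClosed 2 (by exact_mod_cast h2) P
  -- the slice at `λ̄(P)` is the slice at `λ̄²(Q)`
  have hsl : A.sliceAt s D lam P = A.sliceAt s D (lam ^ 2) Q := by rw [A.sliceAt_pow D lam s Q 2, hQ]
  obtain ⟨i⟩ := h Q
  -- `D_P(Θ₁) ∼ D_Q(2•Θ₁)`
  have hlin : ((A.fibre s).toAbelianVariety.weilDiv (2 • Θ₁) Q).LinEquiv ((A.fibre s).toAbelianVariety.weilDiv Θ₁ P) := by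
    rw [← hQ, ← CartierDivisor.cechClass_eq_iff_linEquiv]
    have hsq := (CartierDivisor.cechClass_eq_iff_linEquiv _ _).2 ((A.fibre s).toAbelianVariety.weilDiv_mul_linEquiv Θ₁ Q Q)
    rw [pow_two, hsq, CartierDivisor.cechClass_add, cechClass_weilDiv, cechClass_weilDiv, cechClass_smul', map_pow, ← inv_pow,
      ← mul_pow, pow_two]
  obtain ⟨j⟩ := (weilDiv_linEquiv_iff_nonempty_translateTensorDual_iso (A.fibre s).toAbelianVariety Θ₁ (2 • Θ₁) P Q).1 hlin
  refine ⟨?_ ≪≫ i ≪≫ j⟩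
  exact (Scheme.Modules.pullbackCongr hsl).app D.P

/-! ## §2 `λ̄² = Λ(𝒪(Θ))` ⇒ `A_s[2] ⊆ K(Θ)` -/

/-- **`λ̄² = Λ(𝒪(Θ))` ⇒ every `2`-torsion point of `A_s(Ω)` lies in `K(Θ)`**: `λ̄²(x) = λ̄(x²) = λ̄(1) = λ̄²(1)` (★ `valueAt_pow`), so
`D_x(Θ) ∼ 0` (★ `weilDiv_linEquiv_zero_of_valueAt_eq_valueAt_one`), i.e. `t_x^*Θ ∼ Θ`. [cite: MumfordAV1970, §23 Thm. 3 (p. 231)]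
[cite: MumfordFogartyKirwan1994, Ch. 6 §2 Definition 6.2 (p. 120)] -/
theorem IsLambdaOfAt.linEquiv_pullback_translation_of_sq {lam : A.X ⟶ D.hat.X} [IsMonHom lam]
    {Θ : CartierDivisor (A.fibre s).toAbelianVariety.X.left} (h : A.IsLambdaOfAt s D (lam ^ 2) Θ)
    {x : (A.fibre s).toAbelianVariety.Points Ω} (hx : x * x = 1) :
    (Θ.pullback ((A.fibre s).toAbelianVariety.translation x).left).LinEquiv Θ := by
  have hval : A.valueAt s D (lam ^ 2) x = A.valueAt s D (lam ^ 2) 1 := by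
    rw [A.valueAt_pow D lam s x 2, A.valueAt_pow D lam s 1 2, pow_two, hx, one_pow]
  have h0 := h.weilDiv_linEquiv_zero_of_valueAt_eq_valueAt_one hval
  -- `D_x(Θ) ∼ 0` ⇒ `t_x^*Θ ∼ Θ`
  rw [← CartierDivisor.cechClass_eq_iff_linEquiv] at h0 ⊢
  rw [cechClass_weilDiv, CartierDivisor.cechClass_zero, mul_inv_eq_one] at h0
  rw [CartierDivisor.cechClass_pullback, h0]

/-! ## §3 Bookkeeping for a Néron–Severi half `Θ₁` of `Θ` -/

section Half

variable {X : AbelianVariety Ω} {Θ Θ₁ : CartierDivisor X.X.left}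

/-- `D_a(2•Θ₁) ∼ D_a(Θ)` for a Néron–Severi half `Θ₁` of `Θ` (`t_a^*Θ + 2•Θ₁ ∼ Θ + 2•t_a^*Θ₁`). [cite: MumfordAV1970, §23 Thm. 3 (p. 231)] -/
theorem weilDiv_two_smul_linEquiv_of_half
    (hhalf : ∀ a : X.Points Ω, ((Θ.pullback (X.translation a).left) + 2 • Θ₁).LinEquiv (Θ + 2 • (Θ₁.pullback (X.translation a).left)))
    (a : X.Points Ω) : (X.weilDiv (2 • Θ₁) a).LinEquiv (X.weilDiv Θ a) := by
  have H := (CartierDivisor.cechClass_eq_iff_linEquiv _ _).2 (hhalf a)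
  rw [CartierDivisor.cechClass_add, CartierDivisor.cechClass_add, cechClass_smul', cechClass_smul',
    CartierDivisor.cechClass_pullback, CartierDivisor.cechClass_pullback] at H
  rw [← CartierDivisor.cechClass_eq_iff_linEquiv, cechClass_weilDiv, cechClass_weilDiv, cechClass_smul', map_pow,
    mul_inv_eq_mul_inv_iff_mul_eq_mul, mul_comm (CechPic.pullback (X.translation a).left Θ₁.cechClass ^ 2), ← H]

/-- `Θ ∼ 2•Θ₁ + (Θ − 2•Θ₁)`. [cite: MumfordAV1970, §23 Thm. 3 (p. 231)] -/
theorem linEquiv_two_smul_add_sub (Θ Θ₁ : CartierDivisor X.X.left) : Θ.LinEquiv (2 • Θ₁ + (Θ + -(2 • Θ₁))) := by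
  rw [← CartierDivisor.cechClass_eq_iff_linEquiv, CartierDivisor.cechClass_add, CartierDivisor.cechClass_add, cechClass_neg_eq_inv',
    mul_left_comm, mul_inv_cancel, mul_one]

end Half

/-! ## §4 The (V)-upgrade at a geometric point -/

section Upgrade

variable [IsAlgClosed Ω] [CharZero Ω]

/-- **THE (V)-UPGRADE AT A GEOMETRIC POINT** (characteristic `0`): if `λ̄² = Λ(𝒪(Θ))` at `s` for an AMPLE `Θ` carrying a non-zero
section of an odd multiple, and `λ̄²` is onto on `Ω`-points, then **`λ̄ = Λ(𝒪(Θ₁))` for an AMPLE `Θ₁`** — so a homomorphism whose square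
is fibrewise `Λ` of an ample class is a POLARIZATION at `s` ([MumfordFogartyKirwan1994] Def. 6.3; [GortzWedhorn2023] Prop. 27.284).
Proof: `A_s[2] ⊆ K(Θ)` (§2); a Néron–Severi half `Θ₁` of `Θ` by [MumfordAV1970] §23 Thm. 3 at `n = 2` (★
`exists_forall_linEquiv_two_smul_of_isSection`: theta-function eigendivisor, descent through `[2]`, Néron–Severi bookkeeping — this was
the hypothesis binder `hH2` of edition 1); `λ̄² = Λ(𝒪(2•Θ₁))` (§3 + ★ `of_forall_weilDiv_linEquiv`), `λ̄ = Λ(𝒪(Θ₁))` (§1), and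
`Θ ∼ 2•Θ₁ + N` with `N = Θ − 2•Θ₁` translation-invariant (★ `linEquiv_pullback_translation_sub`) makes `Θ₁` ample (★
`isAmple_of_linEquiv_smul_add`, [MumfordAV1970] §8 Thm. 1). [cite: MumfordAV1970, §23 Thm. 3 (p. 231)]
[cite: MumfordFogartyKirwan1994, Ch. 6 §2 Definition 6.3 (p. 120)] [cite: GortzWedhorn2023, Prop. 27.284] -/
theorem exists_isAmple_isLambdaOfAt_of_sq {lam : A.X ⟶ D.hat.X} [IsMonHom lam]
    (hsurj2 : ∀ y : D.hat.FibrePoints s, ∃ x : A.FibrePoints s, x ≫ (lam ^ 2) = y)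
    {Θ : CartierDivisor (A.fibre s).toAbelianVariety.X.left} (hamp : Θ.IsAmple) {N : ℕ} (hN : Odd N)
    {s₀ : (A.fibre s).toAbelianVariety.X.left.functionField} (hs₀ : s₀ ≠ 0) (hsec : (N • Θ).IsSection s₀)
    (h : A.IsLambdaOfAt s D (lam ^ 2) Θ) :
    ∃ Θ₁ : CartierDivisor (A.fibre s).toAbelianVariety.X.left, Θ₁.IsAmple ∧ A.IsLambdaOfAt s D lam Θ₁ := by
  have h2 : (2 : Ω) ≠ 0 := two_ne_zero
  have hK : ∀ x : (A.fibre s).toAbelianVariety.Points Ω, x * x = 1 →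
      (Θ.pullback ((A.fibre s).toAbelianVariety.translation x).left).LinEquiv Θ :=
    fun x hx => IsLambdaOfAt.linEquiv_pullback_translation_of_sq A D s h hx
  -- the Néron–Severi half ([MumfordAV1970] §23 Thm. 3 at `n = 2`)
  obtain ⟨Θ₁, hΘ₁⟩ := (A.fibre s).toAbelianVariety.exists_forall_linEquiv_two_smul_of_isSection Θ hK N s₀ hN hs₀ hsec
  have hsq : A.IsLambdaOfAt s D (lam ^ 2) (2 • Θ₁) :=
    IsLambdaOfAt.of_forall_weilDiv_linEquiv (h := h) (hlin := fun P => weilDiv_two_smul_linEquiv_of_half hΘ₁ P)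
  have hN' : ∀ P : (A.fibre s).toAbelianVariety.Points Ω,
      ((Θ + -(2 • Θ₁)).pullback ((A.fibre s).toAbelianVariety.translation P).left).LinEquiv (Θ + -(2 • Θ₁)) :=
    fun P => IsLambdaOfAt.linEquiv_pullback_translation_sub h hsq P
  have hlin : Θ.LinEquiv (2 • Θ₁ + (Θ + -(2 • Θ₁))) := linEquiv_two_smul_add_sub Θ Θ₁
  have hamp₁ : Θ₁.IsAmple := IsLambdaOfAt.isAmple_of_linEquiv_smul_add A D s (lam ^ 2) h hamp hsurj2 hN' two_pos hlin
  exact ⟨Θ₁, hamp₁, IsLambdaOfAt.of_sq_two_smul A D s h2 hsq⟩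

end Upgrade

/-! ## §5 Onto-ness of powers, and the `H₅` entry of MFK Prop. 7.3 step (V) -/

/-- **`λ̄` onto on `Ω`-points ⇒ `λ̄ⁿ` onto** (`n ≠ 0` in `Ω`): `y = y′ⁿ` by divisibility of `Â_s(Ω)` (★ `exists_pow_eq_of_isAlgClosed` through
the partner dictionary ★ `exists_points_fibrePointToLeft_eq`, ★ `fibrePointToLeft_pow`), `y′ = x ≫ λ`, and `x ≫ λⁿ = (x ≫ λ)ⁿ`.
[cite: MumfordAV1970, §8 Thm. 1 (p. 77)] [cite: GortzWedhorn2020, Section (4.7), (4.7.1) (p. 108)] -/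
theorem exists_comp_pow_eq_of_exists_comp_eq [IsAlgClosed Ω] {lam : A.X ⟶ D.hat.X}
    (hsurj : ∀ y : D.hat.FibrePoints s, ∃ x : A.FibrePoints s, x ≫ lam = y) {n : ℕ} (hn : (n : Ω) ≠ 0)
    (y : D.hat.FibrePoints s) : ∃ x : A.FibrePoints s, x ≫ (lam ^ n) = y := by
  obtain ⟨Q, hQ⟩ := D.hat.exists_points_fibrePointToLeft_eq s y
  obtain ⟨R, hR⟩ := (D.hat.fibre s).toAbelianVariety.exists_pow_eq_of_isAlgClosed n hn Q
  set y' : D.hat.FibrePoints s := Over.homMk (D.hat.fibrePointToLeft s R) (D.hat.fibrePointToLeft_comp_hom s R) with hy'_def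
  have hy' : y' ^ n = y := by
    apply Over.OverMorphism.ext
    have e1 : (y' ^ n).left = y'.left ≫ ((𝟙 D.hat.X : D.hat.X ⟶ D.hat.X) ^ n).left := by
      rw [← Over.comp_left, MonObj.comp_pow, Category.comp_id]
    rw [e1]
    change D.hat.fibrePointToLeft s R ≫ _ = _
    rw [← D.hat.fibrePointToLeft_pow s R n, hR, hQ]
  obtain ⟨x, hx⟩ := hsurj y'
  exact ⟨x, by rw [MonObj.comp_pow, hx, hy']⟩

section Entry

variable [IsAlgClosed Ω] [CharZero Ω] [IsReduced S] [IsLocallyNoetherian S]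
  (hD : Nonempty ((Scheme.Modules.pullback (DualPair.unitHatSlice D)).obj D.P ≅ SheafOfModules.unit _))

include hD in
/-- **THE `H₅` ENTRY of [MumfordFogartyKirwan1994] Prop. 7.3 step (V), hom form** (B-p17 (g12) census `CENSUS-F6V-LDeltaCubeLocus` §5:
on `H₅` the hom `m` has `[6] ≫ m = Λ(L)` and `L ≅ L^Δ(m)^{⊗3}`), characteristic `0`: at a geometric point, from `λ̄⁶ = Λ(𝒪(Θ₆))` with
`Θ₆` AMPLE carrying a non-zero section of an odd multiple (the hyperplane divisor of `L_s`: `N = 1`, `s₀ = 1`) and `λ̄² = Λ(𝒪(Θ_Δ))`,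
with `λ̄` onto on `Ω`-points and `Â` commutative, **there is an AMPLE `Θ` with `λ̄ = Λ(𝒪(Θ))`** — `λ` is a POLARIZATION at `s` (Def. 6.3
`exists_ample`); unconditional (the Néron–Severi halving binder `hH2` of edition 1 is now ★
`exists_forall_linEquiv_two_smul_of_isSection`).  §4 at `λ³` halves `λ̄⁶` to an ample witness `Θ₃` of `λ̄³`; ★ Bezout
`IsLambdaOfAt.bezout_of_pow` (`3 = 2·1 + 1`) gives the witness `Θ₃ − Θ_Δ` of `λ̄`; it is ample because `Θ₆ ∼ 6•(Θ₃ − Θ_Δ) + N` with `N`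
translation-invariant (★ `pow_nsmul`, ★ `linEquiv_pullback_translation_sub`, ★ `isAmple_of_linEquiv_smul_add`).
[cite: MumfordFogartyKirwan1994, Ch. 7 §2 Prop. 7.3 step (V) (p. 134)]
[cite: MumfordFogartyKirwan1994, Ch. 6 §2 Definition 6.3 (p. 120) and Prop. 6.11 (pp. 122–123)] [cite: MumfordAV1970, §23 Thm. 3 (p. 231)] -/
theorem exists_isAmple_isLambdaOfAt_of_pow_six_of_sq [IsCommMonObj D.hat.X] {lam : A.X ⟶ D.hat.X} [IsMonHom lam]
    (hsurj : ∀ y : D.hat.FibrePoints s, ∃ x : A.FibrePoints s, x ≫ lam = y)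
    {Θ₆ ΘΔ : CartierDivisor (A.fibre s).toAbelianVariety.X.left} (hamp : Θ₆.IsAmple) {N : ℕ} (hN : Odd N)
    {s₀ : (A.fibre s).toAbelianVariety.X.left.functionField} (hs₀ : s₀ ≠ 0) (hsec : (N • Θ₆).IsSection s₀)
    (h6 : A.IsLambdaOfAt s D (lam ^ 6) Θ₆) (hΔ : A.IsLambdaOfAt s D (lam ^ 2) ΘΔ) :
    ∃ Θ : CartierDivisor (A.fibre s).toAbelianVariety.X.left, Θ.IsAmple ∧ A.IsLambdaOfAt s D lam Θ := by
  haveI : IsMonHom (lam ^ 3) := isMonHom_pow D.hat lam 3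
  haveI : IsMonHom (lam ^ 2) := isMonHom_pow D.hat lam 2
  have h6ne : ((6 : ℕ) : Ω) ≠ 0 := Nat.cast_ne_zero.2 (by decide)
  -- §4 at `λ³`: an ample witness `Θ₃` of `λ̄³`
  have h6' : A.IsLambdaOfAt s D ((lam ^ 3) ^ 2) Θ₆ := by rw [← pow_mul]; exact h6
  have hsurj6 : ∀ y : D.hat.FibrePoints s, ∃ x : A.FibrePoints s, x ≫ ((lam ^ 3) ^ 2) = y := fun y => by
    rw [← pow_mul]; exact A.exists_comp_pow_eq_of_exists_comp_eq D s hsurj h6ne y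
  obtain ⟨Θ₃, hamp₃, h3'⟩ := A.exists_isAmple_isLambdaOfAt_of_sq D s hsurj6 hamp hN hs₀ hsec h6'
  -- Bezout `3 = 2·1 + 1`
  have hB : A.IsLambdaOfAt s D lam (Θ₃ + 1 • (-ΘΔ)) :=
    IsLambdaOfAt.bezout_of_pow A D s hD (m := 2) (c := 3) (k := 1) (by norm_num) h3' hΔ
  -- ampleness: `Θ₆ ∼ 6•(Θ₃ − Θ_Δ) + N`, `N` translation invariant
  have h6B : A.IsLambdaOfAt s D (lam ^ 6) (6 • (Θ₃ + 1 • (-ΘΔ))) := IsLambdaOfAt.pow_nsmul A D lam s 6 hB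
  have hNinv : ∀ P : (A.fibre s).toAbelianVariety.Points Ω,
      ((Θ₆ + -(6 • (Θ₃ + 1 • (-ΘΔ)))).pullback ((A.fibre s).toAbelianVariety.translation P).left).LinEquiv
        (Θ₆ + -(6 • (Θ₃ + 1 • (-ΘΔ)))) :=
    fun P => IsLambdaOfAt.linEquiv_pullback_translation_sub h6 h6B P
  have hlin : Θ₆.LinEquiv (6 • (Θ₃ + 1 • (-ΘΔ)) + (Θ₆ + -(6 • (Θ₃ + 1 • (-ΘΔ))))) := by
    rw [← CartierDivisor.cechClass_eq_iff_linEquiv, CartierDivisor.cechClass_add, CartierDivisor.cechClass_add, cechClass_neg_eq_inv',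
      mul_left_comm, mul_inv_cancel, mul_one]
  have hsurj6' : ∀ y : D.hat.FibrePoints s, ∃ x : A.FibrePoints s, x ≫ (lam ^ 6) = y := fun y =>
    A.exists_comp_pow_eq_of_exists_comp_eq D s hsurj h6ne y
  have hampB : (Θ₃ + 1 • (-ΘΔ)).IsAmple :=
    IsLambdaOfAt.isAmple_of_linEquiv_smul_add A D s (lam ^ 6) h6 hamp hsurj6' hNinv (by norm_num) hlin
  exact ⟨_, hampB, hB⟩

end Entry

end AbelianSchemeOver

end Literature.AlgebraicGeometry.AbelianSchemes
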